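import Summits.CriticalPhenomena.CardyFormulaZ2.Theorems.CardyBoundaryCoulombGasBoundaryDefectGaussianRStubRealisabilityPart1
import Literature.Probability.LatticeModels.CollarLegModelSanity

/-!
# Stub `stub_realisability` of line `rainbow-monomials-in-excursion-kernels` — Part 2:
# heights ↦ arrows for the closed collar: weight matching and injectivity
# (crux `BoundaryDefectGaussianR`, stmt-CriticalPhenomena-14132)

Second third of the closed-collar dictionary D1 (`(ofDomain V).Z = 2^{|E|}` on hole-free `V`)
for `Literature.Probability.LatticeModels.CollarLegModel`, continuing Part 1. A height
configuration `h` of the closed collar `ofDomain V` orients every corner `c = (x, k)` over the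
piece `Λ` (`x ∈ Λ ↔ (x 0, x 1) ∈ V`): the arrow bit of `c` is `[h(x) - h(face_k x) = +1]`
(hypothesis `hs`, the only way the arrow configuration `s` enters — no definition is introduced).

* `localW_live_eq_liveWeight`, `localW_bdry_eq_closedWeight` — at a live edge the sum of the
  closed and open local BKW weights of `s` is the six-vertex weight `liveWeight h e`
  (`1, 1, 1, 1, √3, √3`; `2cos(λ/2) = √3` at `λ = arccos(1/2) = π/3`), at an exterior edge the
  boundary local weight is the collar phase `closedWeight h e = e^{iπ h(v)/12}`;
* `weight_eq_bkwWeight` — hence `weight h = W_Λ(s)` (`BKW.bkwWeight` at `q = 1`);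
* `heights_eq_of_arrows_eq` — two height configurations with the same arrows coincide (walk east
  to a collar face).

Registered sub-goal carried here: `s9_weightMatching`.
-/

noncomputable section

namespace Summit.CriticalPhenomena.CardyFormulaZ2.Cruxes.BoundaryDefectGaussianR.RainbowMonomialsInExcursionKernels

open Finset Literature.Probability.LatticeModels Literature.Probability.Percolation
open Literature.Probability.Percolation.BKW Literature.Probability.LatticeModels.CollarLegModel

/-! ### Trigonometry at `q = 1` -/

/-- `λ(1) = arccos(1/2) = π/3`. [cite: DuminilCopinKozlowskiLammersManolescu2026, §3.2] -/
theorem lam_one : lam 1 = Real.pi / 3 := by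
  rw [lam, Real.sqrt_one, ← Real.cos_pi_div_three, Real.arccos_cos]
  · positivity
  · linarith [Real.pi_pos]

/-- The c-weight at `q = 1`: `2cos(λ/2) = 2cos(π/6) = √3`. [cite: BaxterKellandWu1976, §4] -/
theorem two_cos_lam_one_half : (2 * Real.cos (lam 1 / 2) : ℂ) = ((Real.sqrt 3 : ℝ) : ℂ) := by
  rw [lam_one, show Real.pi / 3 / 2 = Real.pi / 6 by ring, Real.cos_pi_div_six]
  push_cast; ring

/-- The left quarter-turn phase `e^{iλ/4} = e^{iπ/12}` is `phase 1`. [cite: BaxterKellandWu1976, §4] -/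
theorem exp_lam_quarter : Complex.exp (Complex.I * ((lam 1 : ℂ) / 4)) = phase 1 := by
  rw [phase, lam_one]
  congr 1
  push_cast
  ring

/-- The right quarter-turn phase `e^{-iλ/4} = e^{-iπ/12}` is `phase (-1)`. [cite: BaxterKellandWu1976, §4] -/
theorem exp_neg_lam_quarter : Complex.exp (-(Complex.I * ((lam 1 : ℂ) / 4))) = phase (-1) := by
  rw [phase, lam_one]
  congr 1
  push_cast
  ring

/-- **The six-vertex table at `q = 1` read on height differences**: with the four corner bits of
a live edge `{x, y}` (side faces `f`, `g`) written as `[x - g = 1], [y - f = 1], [x - f = 1],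
[y - g = 1]` for heights at unit distance, `sixVertexLocalWeight` is `√3` in the c-type case
`x = y ∧ f = g` and `1` otherwise. [cite: BaxterKellandWu1976, §4] -/
theorem sixVertexLocalWeight_heights {x y f g : ℤ} (h1 : |x - g| = 1) (h2 : |y - f| = 1) (h3 : |x - f| = 1)
    (h4 : |y - g| = 1) :
    sixVertexLocalWeight 1 (decide (x - g = 1)) (decide (y - f = 1)) (decide (x - f = 1)) (decide (y - g = 1)) =
      if x = y ∧ f = g then ((Real.sqrt 3 : ℝ) : ℂ) else 1 := by
  rw [sixVertexLocalWeight, two_cos_lam_one_half]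
  rw [abs_eq (zero_le_one)] at h1 h2 h3 h4
  rcases h1 with h1 | h1 <;> rcases h2 with h2 | h2 <;> rcases h3 with h3 | h3 <;> rcases h4 with h4 | h4 <;>
    simp only [h1, h2, h3, h4] <;> norm_num <;> omega

/-! ### Face bookkeeping at a coded edge -/

/-- The left face of a coded edge is the face `dir` around its first endpoint. [folklore] -/
theorem leftFace_true_eq (e : (ℤ × ℤ) × Bool) : SixVertex.leftFace e true =
    ![e.1, (e.1.1 - 1, e.1.2), (e.1.1 - 1, e.1.2 - 1), (e.1.1, e.1.2 - 1)] (if e.2 then 1 else 0 : Fin 4) := by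
  obtain ⟨a, d⟩ := e; cases d <;> rfl

/-- The right face of a coded edge is the face `dir + 3` around its first endpoint. [folklore] -/
theorem leftFace_false_eq (e : (ℤ × ℤ) × Bool) : SixVertex.leftFace e false =
    ![e.1, (e.1.1 - 1, e.1.2), (e.1.1 - 1, e.1.2 - 1), (e.1.1, e.1.2 - 1)] ((if e.2 then 1 else 0 : Fin 4) + 3) := by
  obtain ⟨a, d⟩ := e; cases d <;> rfl

/-- The left face of a coded edge is the face `dir + 1` around its far endpoint. [folklore] -/
theorem face_tip_one (e : (ℤ × ℤ) × Bool) :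
    ![SixVertex.edgeTip e, ((SixVertex.edgeTip e).1 - 1, (SixVertex.edgeTip e).2),
      ((SixVertex.edgeTip e).1 - 1, (SixVertex.edgeTip e).2 - 1), ((SixVertex.edgeTip e).1, (SixVertex.edgeTip e).2 - 1)]
      ((if e.2 then 1 else 0 : Fin 4) + 1) = SixVertex.leftFace e true := by
  obtain ⟨a, d⟩ := e; cases d <;> simp [SixVertex.edgeTip, SixVertex.leftFace]

/-- The right face of a coded edge is the face `dir + 2` around its far endpoint. [folklore] -/
theorem face_tip_two (e : (ℤ × ℤ) × Bool) :
    ![SixVertex.edgeTip e, ((SixVertex.edgeTip e).1 - 1, (SixVertex.edgeTip e).2),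
      ((SixVertex.edgeTip e).1 - 1, (SixVertex.edgeTip e).2 - 1), ((SixVertex.edgeTip e).1, (SixVertex.edgeTip e).2 - 1)]
      ((if e.2 then 1 else 0 : Fin 4) + 2) = SixVertex.leftFace e false := by
  obtain ⟨a, d⟩ := e; cases d <;> simp [SixVertex.edgeTip, SixVertex.leftFace]

/-- The first endpoint of a coded edge is a corner of both its side faces. [folklore] -/
theorem fst_mem_faceCorners_leftFace (e : (ℤ × ℤ) × Bool) (b : Bool) : e.1 ∈ SixVertex.faceCorners (SixVertex.leftFace e b) := by
  obtain ⟨a, d⟩ := e; cases d <;> cases b <;> simp [SixVertex.faceCorners, SixVertex.leftFace]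

/-- The far endpoint of a coded edge is a corner of both its side faces. [folklore] -/
theorem tip_mem_faceCorners_leftFace (e : (ℤ × ℤ) × Bool) (b : Bool) :
    SixVertex.edgeTip e ∈ SixVertex.faceCorners (SixVertex.leftFace e b) := by
  obtain ⟨a, d⟩ := e; cases d <;> cases b <;> simp [SixVertex.faceCorners, SixVertex.leftFace, SixVertex.edgeTip]

/-- The partner of the corner at the first endpoint of a coded edge is the corner `dir + 1` at its far endpoint. [folklore] -/
theorem cornerPartner_edge (e : (ℤ × ℤ) × Bool) : cornerPartner ((![e.1.1, e.1.2] : Site 2), (if e.2 then 1 else 0 : Fin 4) + 3) =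
    (![(SixVertex.edgeTip e).1, (SixVertex.edgeTip e).2], (if e.2 then 1 else 0 : Fin 4) + 1) := by
  have hj : ∀ j : Fin 4, j + 3 + 1 = j := by decide
  have hj' : ∀ j : Fin 4, j + 3 + 2 = j + 1 := by decide
  rw [cornerPartner, vec_edgeTip]
  simp only [hj, hj']

section Matching

variable {V : Finset (ℤ × ℤ)} {Λ : Finset (Site 2)} (hΛ : ∀ x : Site 2, x ∈ Λ ↔ (x 0, x 1) ∈ V)
variable {h : ↥(ofDomain V).freeCells → ℤ} {s : ↥(cornerSet Λ) → Bool}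
  (hs : ∀ c : ↥(cornerSet Λ), s c = decide ((ofDomain V).hv h ((c : Site 2 × Fin 4).1 0, (c : Site 2 × Fin 4).1 1) -
    (ofDomain V).hf h (cFace (c : Site 2 × Fin 4) 0, cFace (c : Site 2 × Fin 4) 1) = 1))
include hs

/-- Reading the arrow bit of the corner `(a, k)`, `a ∈ V`. [folklore] -/
theorem apply_eq_decide {c : Site 2 × Fin 4} (hc : c ∈ cornerSet Λ) {a : ℤ × ℤ} {k : Fin 4}
    (heq : c = ((![a.1, a.2] : Site 2), k)) :
    s ⟨c, hc⟩ = decide ((ofDomain V).hv h a - (ofDomain V).hf h (![a, (a.1 - 1, a.2), (a.1 - 1, a.2 - 1), (a.1, a.2 - 1)] k) = 1) := by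
  subst heq
  rw [hs]
  simp [cFace_vec]

include hΛ

/-- **Weight matching at a live edge**: the sum of the closed and open local BKW weights of the
arrows of `h` at a live coded edge is the six-vertex weight `liveWeight h e`. [cite: BaxterKellandWu1976, §4] -/
theorem localW_live_eq_liveWeight (hval : (ofDomain V).IsValid h) {e : (ℤ × ℤ) × Bool} (he : e ∈ inducedEdges V) :
    localW (fun c : ↥(cornerSet Λ) => cTgt (c : Site 2 × Fin 4)) (follow₀ Λ) (fun _ => 1) 1 s
        (s(![e.1.1, e.1.2], ![(SixVertex.edgeTip e).1, (SixVertex.edgeTip e).2]) : Sym2 (Site 2)) +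
      localW (fun c : ↥(cornerSet Λ) => cTgt (c : Site 2 × Fin 4)) (follow₁ Λ) (fun _ => -1) 1 s
        (s(![e.1.1, e.1.2], ![(SixVertex.edgeTip e).1, (SixVertex.edgeTip e).2]) : Sym2 (Site 2)) =
      (ofDomain V).liveWeight h e := by
  have hmem := (edge_mem_pieceEdges_iff hΛ).2 he
  have he' := he
  rw [inducedEdges, mem_filter] at he'
  have hp : ((![e.1.1, e.1.2] : Site 2), (if e.2 then 1 else 0 : Fin 4) + 3) ∈ cornerSet Λ :=
    mem_cornerSet.2 ((vec_mem_iff hΛ _).2 he'.2.1)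
  rw [edge_eq_cTgt_fst] at hmem ⊢
  rw [localW_closed_add_localW_open 1 s (p := ⟨_, hp⟩) hmem]
  have hj : ∀ j : Fin 4, j + 3 + 1 = j := by decide
  have hj2 : ∀ j : Fin 4, j + 1 + 1 = j + 2 := by decide
  rw [apply_eq_decide hs _ rfl, apply_eq_decide hs _ (cornerPartner_edge e),
    apply_eq_decide hs _ (show ((follow₀ Λ ⟨_, hp⟩ : ↥(cornerSet Λ)) : Site 2 × Fin 4) =
      ((![e.1.1, e.1.2] : Site 2), (if e.2 then 1 else 0 : Fin 4)) by rw [follow₀]; dsimp only; rw [hj]),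
    apply_eq_decide hs _ (show ((follow₀ Λ ⟨cornerPartner _, cornerPartner_mem_cornerSet hmem⟩ : ↥(cornerSet Λ)) :
      Site 2 × Fin 4) = ((![(SixVertex.edgeTip e).1, (SixVertex.edgeTip e).2] : Site 2), (if e.2 then 1 else 0 : Fin 4) + 2) by
        rw [follow₀]; dsimp only; rw [cornerPartner_edge, hj2])]
  have k1 := abs_sub_eq_one_of_valid hval he'.2.1 ((if e.2 then 1 else 0 : Fin 4) + 3)
  have k2 := abs_sub_eq_one_of_valid hval he'.2.2 ((if e.2 then 1 else 0 : Fin 4) + 1)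
  have k3 := abs_sub_eq_one_of_valid hval he'.2.1 (if e.2 then 1 else 0 : Fin 4)
  have k4 := abs_sub_eq_one_of_valid hval he'.2.2 ((if e.2 then 1 else 0 : Fin 4) + 2)
  rw [face_tip_one] at k2 ⊢
  rw [face_tip_two] at k4 ⊢
  rw [← leftFace_true_eq] at k3 ⊢
  rw [← leftFace_false_eq] at k1 ⊢
  rw [sixVertexLocalWeight_heights k1 k2 k3 k4, liveWeight]

/-- **Weight matching at an exterior edge**: the boundary local BKW weight of the arrows of `h` at
an exterior coded edge is the collar phase `closedWeight h e`. [cite: BaxterKellandWu1976, §4] -/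
theorem localW_bdry_eq_closedWeight (hval : (ofDomain V).IsValid h) {e : (ℤ × ℤ) × Bool}
    (he : e ∈ SixVertex.edges V \ inducedEdges V) :
    localW (fun c : ↥(cornerSet Λ) => cTgt (c : Site 2 × Fin 4)) (follow₀ Λ) (fun _ => 1) 1 s
        (s(![e.1.1, e.1.2], ![(SixVertex.edgeTip e).1, (SixVertex.edgeTip e).2]) : Sym2 (Site 2)) =
      (ofDomain V).closedWeight h e := by
  rw [mem_sdiff] at he
  have hnot : (s(![e.1.1, e.1.2], ![(SixVertex.edgeTip e).1, (SixVertex.edgeTip e).2]) : Sym2 (Site 2)) ∉ pieceEdges Λ :=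
    fun h' => he.2 ((edge_mem_pieceEdges_iff hΛ).1 h')
  have hends : e.1 ∈ V ∨ SixVertex.edgeTip e ∈ V := by
    have h1 := he.1
    rw [SixVertex.edges, mem_biUnion] at h1
    obtain ⟨v, hv, hev⟩ := h1
    rw [SixVertex.mem_vertexEdges_iff] at hev
    rcases hev with rfl | rfl
    · exact Or.inl hv
    · exact Or.inr hv
  have hout : e.1 ∉ V ∨ SixVertex.edgeTip e ∉ V := by
    by_cases h1 : e.1 ∈ V
    · exact Or.inr fun h2 => he.2 (mem_filter.2 ⟨he.1, h1, h2⟩)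
    · exact Or.inl h1
  have hfT : SixVertex.leftFace e true ∈ (ofDomain V).faceCells ∧ SixVertex.leftFace e false ∈ (ofDomain V).faceCells := by
    rcases hends with h1 | h1
    · exact ⟨mem_biUnion.2 ⟨_, h1, leftFace_true_eq e ▸ face_mem_vertexFaces _ _⟩,
        mem_biUnion.2 ⟨_, h1, leftFace_false_eq e ▸ face_mem_vertexFaces _ _⟩⟩
    · exact ⟨mem_biUnion.2 ⟨_, h1, face_tip_one e ▸ face_mem_vertexFaces _ _⟩,
        mem_biUnion.2 ⟨_, h1, face_tip_two e ▸ face_mem_vertexFaces _ _⟩⟩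
  have hcollar : ∀ b, SixVertex.leftFace e b ∉ interiorFaces V := by
    intro b hb
    rw [interiorFaces, mem_filter] at hb
    rcases hout with h1 | h1
    · exact h1 (hb.2 (fst_mem_faceCorners_leftFace e b))
    · exact h1 (hb.2 (tip_mem_faceCorners_leftFace e b))
  have hT := hf_ofDomain_of_not_mem h (hcollar true)
  have hF := hf_ofDomain_of_not_mem h (hcollar false)
  have hj : ∀ j : Fin 4, j + 3 + 1 = j := by decide
  have hj2 : ∀ j : Fin 4, j + 1 + 1 = j + 2 := by decide
  rw [closedWeight, closedFactor, closedFactor, vertexCells_ofDomain, hT, hF]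
  by_cases h1 : e.1 ∈ V
  · have h2 : SixVertex.edgeTip e ∉ V := hout.resolve_left (not_not.2 h1)
    have hp : ((![e.1.1, e.1.2] : Site 2), (if e.2 then 1 else 0 : Fin 4) + 3) ∈ cornerSet Λ :=
      mem_cornerSet.2 ((vec_mem_iff hΛ _).2 h1)
    rw [edge_eq_cTgt_fst] at hnot ⊢
    rw [localW_boundary 1 s (p := ⟨_, hp⟩) hnot, apply_eq_decide hs _ rfl,
      apply_eq_decide hs _ (show ((follow₀ Λ ⟨_, hp⟩ : ↥(cornerSet Λ)) : Site 2 × Fin 4) =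
        ((![e.1.1, e.1.2] : Site 2), (if e.2 then 1 else 0 : Fin 4)) by rw [follow₀]; dsimp only; rw [hj])]
    have k := abs_sub_eq_one_of_valid hval h1 (if e.2 then 1 else 0 : Fin 4)
    rw [← leftFace_true_eq, hT] at k
    rw [← leftFace_true_eq, ← leftFace_false_eq, hT, hF]
    simp only [hfT, h1, h2, and_true, if_true, if_false, mul_one, sub_zero] at k ⊢
    rw [abs_eq zero_le_one] at k
    rcases k with k | k <;> rw [k] <;> simp [sgn, exp_lam_quarter, exp_neg_lam_quarter]
  · have h2 : SixVertex.edgeTip e ∈ V := hends.resolve_left h1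
    have hp : ((![(SixVertex.edgeTip e).1, (SixVertex.edgeTip e).2] : Site 2), (if e.2 then 1 else 0 : Fin 4) + 1) ∈ cornerSet Λ :=
      mem_cornerSet.2 ((vec_mem_iff hΛ _).2 h2)
    rw [edge_eq_cTgt_snd] at hnot ⊢
    rw [localW_boundary 1 s (p := ⟨_, hp⟩) hnot, apply_eq_decide hs _ rfl,
      apply_eq_decide hs _ (show ((follow₀ Λ ⟨_, hp⟩ : ↥(cornerSet Λ)) : Site 2 × Fin 4) =
        ((![(SixVertex.edgeTip e).1, (SixVertex.edgeTip e).2] : Site 2), (if e.2 then 1 else 0 : Fin 4) + 2) by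
          rw [follow₀]; dsimp only; rw [hj2])]
    have k := abs_sub_eq_one_of_valid hval h2 ((if e.2 then 1 else 0 : Fin 4) + 1)
    rw [face_tip_one, hT] at k
    rw [face_tip_one, face_tip_two, hT, hF]
    simp only [hfT, h1, h2, and_true, if_true, if_false, one_mul, sub_zero] at k ⊢
    rw [abs_eq zero_le_one] at k
    rcases k with k | k <;> rw [k] <;> simp [sgn, exp_lam_quarter, exp_neg_lam_quarter]

/-- **Weight matching**: the collar weight of a height configuration of the closed collar is the
BKW six-vertex weight (`q = 1`) of its arrow configuration. [cite: BaxterKellandWu1976, §4] -/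
theorem weight_eq_bkwWeight (hval : (ofDomain V).IsValid h) :
    (ofDomain V).weight h = bkwWeight (finsetGraph (zdGraph 2) Λ).edgeFinset.powerset (pieceCornerPerm Λ) (pieceTurn Λ) 1 s := by
  rw [bkwWeight_free_piece_eq_prod, image_cTgt_sdiff_pieceEdges hΛ, pieceEdges_eq_image hΛ,
    prod_image edge_injective.injOn, prod_image edge_injective.injOn, weight, frozenEdges_ofDomain, mul_comm]
  congr 1
  · refine prod_congr rfl fun e he => ?_
    rw [frozenWeight_ofDomain, localW_bdry_eq_closedWeight hΛ hs hval he]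
  · exact prod_congr rfl fun e he => (localW_live_eq_liveWeight hΛ hs hval he).symm

end Matching

/-! ### Injectivity: heights are determined by their arrows -/

section Injectivity

variable {V : Finset (ℤ × ℤ)} {Λ : Finset (Site 2)} (hΛ : ∀ x : Site 2, x ∈ Λ ↔ (x 0, x 1) ∈ V)
variable {h₁ h₂ : ↥(ofDomain V).freeCells → ℤ} {s : ↥(cornerSet Λ) → Bool}
  (hs₁ : ∀ c : ↥(cornerSet Λ), s c = decide ((ofDomain V).hv h₁ ((c : Site 2 × Fin 4).1 0, (c : Site 2 × Fin 4).1 1) -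
    (ofDomain V).hf h₁ (cFace (c : Site 2 × Fin 4) 0, cFace (c : Site 2 × Fin 4) 1) = 1))
  (hs₂ : ∀ c : ↥(cornerSet Λ), s c = decide ((ofDomain V).hv h₂ ((c : Site 2 × Fin 4).1 0, (c : Site 2 × Fin 4).1 1) -
    (ofDomain V).hf h₂ (cFace (c : Site 2 × Fin 4) 0, cFace (c : Site 2 × Fin 4) 1) = 1))
include hΛ hs₁ hs₂

/-- Equal arrows give equal height differences across every corner over `V`. [folklore] -/
theorem hv_sub_hf_eq_of_arrows_eq (hv₁ : (ofDomain V).IsValid h₁) (hv₂ : (ofDomain V).IsValid h₂) {a : ℤ × ℤ} (ha : a ∈ V)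
    (k : Fin 4) :
    (ofDomain V).hv h₁ a - (ofDomain V).hf h₁ (![a, (a.1 - 1, a.2), (a.1 - 1, a.2 - 1), (a.1, a.2 - 1)] k) =
      (ofDomain V).hv h₂ a - (ofDomain V).hf h₂ (![a, (a.1 - 1, a.2), (a.1 - 1, a.2 - 1), (a.1, a.2 - 1)] k) := by
  have e1 := abs_sub_eq_one_of_valid hv₁ ha k
  have e2 := abs_sub_eq_one_of_valid hv₂ ha k
  have hc : ((![a.1, a.2] : Site 2), k) ∈ cornerSet Λ := mem_cornerSet.2 ((vec_mem_iff hΛ _).2 ha)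
  have e3 := apply_eq_decide hs₁ hc rfl
  rw [apply_eq_decide hs₂ hc rfl] at e3
  simp only [decide_eq_decide] at e3
  rw [abs_eq zero_le_one] at e1 e2
  omega

/-- Equal arrows give equal vertex heights: induction on the distance to the eastern exit from `V`,
where the north-east face is a collar face at height `0`. [folklore] -/
theorem hv_eq_of_arrows_eq (hv₁ : (ofDomain V).IsValid h₁) (hv₂ : (ofDomain V).IsValid h₂) :
    ∀ n : ℕ, ∀ a ∈ V, (∀ b ∈ V, b.2 = a.2 → b.1 ≤ a.1 + n) → (ofDomain V).hv h₁ a = (ofDomain V).hv h₂ a := by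
  have hexit : ∀ a ∈ V, (a.1 + 1, a.2) ∉ V → (ofDomain V).hv h₁ a = (ofDomain V).hv h₂ a := by
    intro a ha hout
    have hcol : (![a, (a.1 - 1, a.2), (a.1 - 1, a.2 - 1), (a.1, a.2 - 1)] 0) ∉ interiorFaces V := fun h => by
      rw [interiorFaces, mem_filter] at h
      exact hout (h.2 (by simp [SixVertex.faceCorners]))
    have := hv_sub_hf_eq_of_arrows_eq hΛ hs₁ hs₂ hv₁ hv₂ ha 0
    rwa [hf_ofDomain_of_not_mem _ hcol, hf_ofDomain_of_not_mem _ hcol, sub_zero, sub_zero] at this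
  intro n
  induction n with
  | zero =>
    intro a ha hb
    exact hexit a ha fun h => by have := hb _ h rfl; simp at this
  | succ n ih =>
    intro a ha hb
    by_cases hout : (a.1 + 1, a.2) ∈ V
    · have e1 := ih _ hout fun b hb' hb2 => by have := hb b hb' hb2; simp only at this ⊢; omega
      have e2 := hv_sub_hf_eq_of_arrows_eq hΛ hs₁ hs₂ hv₁ hv₂ hout 1
      have e3 := hv_sub_hf_eq_of_arrows_eq hΛ hs₁ hs₂ hv₁ hv₂ ha 0
      simp only [Matrix.cons_val_one, Matrix.cons_val_zero, add_sub_cancel_right, Prod.mk.eta] at e2 e3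
      omega
    · exact hexit a ha hout

/-- **Injectivity**: two height configurations of the closed collar with the same arrow
configuration are equal. [folklore] -/
theorem heights_eq_of_arrows_eq (hh₁ : h₁ ∈ (ofDomain V).configs) (hh₂ : h₂ ∈ (ofDomain V).configs) : h₁ = h₂ := by
  have hv₁ := (mem_configs_iff_isValid _ _).1 hh₁
  have hv₂ := (mem_configs_iff_isValid _ _).1 hh₂
  obtain ⟨N, hN⟩ : ∃ N : ℕ, ∀ a ∈ V, ∀ b ∈ V, b.1 ≤ a.1 + N := by
    obtain ⟨M, hM⟩ := Finset.bddAbove (V.image Prod.fst)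
    obtain ⟨m, hm⟩ := Finset.bddBelow (V.image Prod.fst)
    refine ⟨(M - m).toNat, fun a ha b hb => ?_⟩
    have e1 : b.1 ≤ M := hM (mem_coe.2 (mem_image_of_mem _ hb))
    have e2 : m ≤ a.1 := hm (mem_coe.2 (mem_image_of_mem _ ha))
    have e3 : M - m ≤ ((M - m).toNat : ℤ) := Int.self_le_toNat _
    omega
  have hvx : ∀ a ∈ V, (ofDomain V).hv h₁ a = (ofDomain V).hv h₂ a :=
    fun a ha => hv_eq_of_arrows_eq hΛ hs₁ hs₂ hv₁ hv₂ N a ha fun b hb _ => hN a ha b hb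
  funext c
  obtain ⟨⟨x, b⟩, hc⟩ := c
  cases b
  · have hx := mem_freeCells_false_ofDomain.1 hc
    have := hvx x hx
    rwa [hv_of_mem _ _ hc, hv_of_mem _ _ hc] at this
  · have hx := mem_freeCells_true_ofDomain.1 hc
    have hxV : x ∈ V := (mem_filter.1 hx).2 (by simp [SixVertex.faceCorners])
    have e1 := hv_sub_hf_eq_of_arrows_eq hΛ hs₁ hs₂ hv₁ hv₂ hxV 0
    have e2 := hvx x hxV
    simp only [Matrix.cons_val_zero] at e1
    rw [hf_of_mem _ _ hc, hf_of_mem _ _ hc] at e1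
    omega

end Injectivity

/-! ### Registered sub-goal of this Part -/

/-- **Sub-goal `s9_weightMatching`** (registered on stmt-CriticalPhenomena-14132): for every height
configuration `h` of the closed collar on `V`, the collar weight `weight h` (six-vertex weights
`1, √3` at live edges, phases `e^{iπ h(v)/12}` at exterior edges) equals the Baxter–Kelland–Wu
six-vertex weight at `q = 1` of its arrow configuration on the corners over
`V.image fun v ↦ ![v.1, v.2]` (bit of `(x, k)` = `[h(x) - h(face_k x) = 1]`). [cite: BaxterKellandWu1976, §4] -/
theorem s9_weightMatching : ∀ (V : Finset (ℤ × ℤ)) (h : ↥(Literature.Probability.LatticeModels.CollarLegModel.ofDomain V).freeCells → ℤ), (Literature.Probability.LatticeModels.CollarLegModel.ofDomain V).IsValid h → (Literature.Probability.LatticeModels.CollarLegModel.ofDomain V).weight h = Literature.Probability.Percolation.BKW.bkwWeight (Literature.Probability.LatticeModels.finsetGraph (Literature.Probability.LatticeModels.zdGraph 2) (V.image fun v : ℤ × ℤ => (![v.1, v.2] : Literature.Probability.LatticeModels.Site 2))).edgeFinset.powerset (Literature.Probability.Percolation.pieceCornerPerm (V.image fun v : ℤ × ℤ => (![v.1, v.2]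 : Literature.Probability.LatticeModels.Site 2))) (Literature.Probability.Percolation.pieceTurn (V.image fun v : ℤ × ℤ => (![v.1, v.2] : Literature.Probability.LatticeModels.Site 2))) 1 (fun c => decide ((Literature.Probability.LatticeModels.CollarLegModel.ofDomain V).hv h ((c : Literature.Probability.LatticeModels.Site 2 × Fin 4).1 0, (c : Literature.Probability.LatticeModels.Site 2 × Fin 4).1 1) - (Literature.Probability.LatticeModels.CollarLegModel.ofDomain V).hf h (Literature.Probability.LatticeModels.cFace (c : Literature.Probability.LatticeModels.Site 2 × Fin 4) 0, Literature.Probability.LatticeModels.cFace (c : Literature.Probability.LatticeModels.Site 2 × Fin 4) 1) = 1)) :=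
  fun V _ hval => by
    refine weight_eq_bkwWeight (fun x => ?_) (fun _ => rfl) hval
    rw [mem_image]
    constructor
    · rintro ⟨v, hv, rfl⟩; simpa using hv
    · intro h; exact ⟨_, h, by funext j; fin_cases j <;> rfl⟩

end Summit.CriticalPhenomena.CardyFormulaZ2.Cruxes.BoundaryDefectGaussianR.RainbowMonomialsInExcursionKernels

end
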